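import Summits.ValiantsHypothesis.ValiantsHypothesis.Theorems.BarrierLeverPartitionMinorsHitByVPOfLowerSets
import Summits.ValiantsHypothesis.ValiantsHypothesis.Theorems.BarrierLeverPartitionMinorsHitByVPHiddenStatesBall
import Summits.ValiantsHypothesis.ValiantsHypothesis.Theorems.BarrierLeverPartitionMinorsHitByVPAdditiveSum
import Summits.ValiantsHypothesis.ValiantsHypothesis.Theorems.BarrierLeverPartitionMinorsHitByVPRoabpDoor
import Summits.ValiantsHypothesis.ValiantsHypothesis.Theorems.BarrierLeverChowHitsReadOnceDeterminantsLadder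

/-!
# Route BarrierLever — item `PartitionMinorsHitByVP` (stmt-ValiantsHypothesis-19717):
# the LOWER-SET REDUCTION by name, and every door of record restricted to simplicial complexes

Link file (`--supports stmt-ValiantsHypothesis-19717`; cell valiant-natproofs, rung V4, 𝒟-side door
(c); prover seat val-np-p1 gen 12). Definition-free. Closes NO item. The mathematics is the
route-independent core `…PartitionMinorsHitByVPOfLowerSets` (`exists_smallCircuit_of_lowerSets`: for
EVERY witness class, hitting the injective layouts whose row family and column family are LOWER SETS
suffices — multiply the witness by `∏_a (1 + t_a x_a) ∏_c (1 + s_c y_c)` and truncate); this file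
states the consequences against the route declaration and the cell's doors.

* `partitionMinorsHitByVP_of_lowerSets` — **THE REDUCTION**: if for some `b, h₀` every injective layout
  `(u, w)` with `h ≥ h₀` and BOTH ranges lower sets is hit inside `SmallCircuits ℂ (h+h) b`, then
  `Theses.BarrierLever.PartitionMinorsHitByVP` (with `b + 4`, from `max h₀ 4` on).
* `partitionMinorsHitByVP_of_ballGood_lowerSets` — for the door of record (val-np-p3's hidden-state
  door `HiddenStates.partitionMinor_hit_of_ballGood_pair`): **Conjecture Q\* (`HiddenStates.BallGood
  h h r u`) is needed ONLY for injective column families whose range is a lower set** (a simplicial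
  complex with `r` faces).
* `partitionMinorsHitByVP_of_additiveSum_lowerSets` (val-np-p6's SUM door,
  `AdditiveDoor.partitionMinor_hit_of_additiveSum_mem`), `partitionMinorsHitByVP_of_roabp_lowerSets`
  (the planner's ROABP door, `RoabpDoor.partitionMinor_hit_of_roabpCertificate`),
  `partitionMinorsHitByVP_of_chow_lowerSets` (the CPM witness shape of item 20172 — one product of
  `h+h` affine forms — via `ChowLadder.prod_affine_mem_smallCircuits`): every conjecture of record may
  restrict its universally quantified layouts to pairs of simplicial complexes.

WHAT THIS IS NOT: no proof of the lower-set case, of Q\*, of the SUM / ROABP / CPM conjectures, or of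
item 19717; nothing on crux stmt-ValiantsHypothesis-14610 or on `VP` versus `VNP`.
-/

set_option linter.dupNamespace false

namespace Summit.ValiantsHypothesis.ValiantsHypothesis.Theorems.BarrierLever.DownCompression

open Finset MvPolynomial
open Literature.Barriers.ValiantsHypothesis

noncomputable section

/-! ## 1. The link to item 19717 -/

/-- **THE LOWER-SET REDUCTION of item 19717.** If for some `b, h₀` every injective layout `(u, w)`
with `h ≥ h₀` whose row family and column family both have LOWER-SET ranges (simplicial complexes)
admits `f ∈ SmallCircuits ℂ (h+h) b` with nonzero partition minor, then
`Theses.BarrierLever.PartitionMinorsHitByVP` holds (with exponent `b + 4` from height `max h₀ 4` on). -/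
theorem partitionMinorsHitByVP_of_lowerSets
    (hyp : ∃ b h₀ : ℕ, ∀ h : ℕ, h₀ ≤ h → ∀ (r : ℕ) (u w : Fin r → Finset (Fin h)),
      Function.Injective u → Function.Injective w →
      IsLowerSet (Set.range u) → IsLowerSet (Set.range w) →
      ∃ f ∈ SmallCircuits ℂ (h + h) b,
        (Matrix.of fun i j : Fin r => MvPolynomial.coeff
          (∑ a ∈ u i, Finsupp.single (Fin.castAdd h a) 1 +
            ∑ c ∈ w j, Finsupp.single (Fin.natAdd h c) 1) f).det ≠ 0) :
    Summit.ValiantsHypothesis.ValiantsHypothesis.Theses.BarrierLever.PartitionMinorsHitByVP := by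
  obtain ⟨b, h₀, H⟩ := hyp
  exact ⟨b + 4, max h₀ 4, fun h hh r u w hu hw =>
    exists_smallCircuit_of_lowerSets b h₀ H h hh r u w hu hw⟩

/-- **Conjecture Q\* on simplicial complexes suffices.** If for `h ≥ h₁` every injective family
`u : Fin r → Finset (Fin h)` whose range is a LOWER SET is ball-good (`HiddenStates.BallGood h h r u`,
val-np-p3's Conjecture Q\* with `K = h` hidden states), then `PartitionMinorsHitByVP` holds
(through `HiddenStates.partitionMinor_hit_of_ballGood_pair`, `b = 10`, from `max h₁ 5` on). -/
theorem partitionMinorsHitByVP_of_ballGood_lowerSets (h₁ : ℕ)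
    (H : ∀ h : ℕ, h₁ ≤ h → ∀ (r : ℕ) (u : Fin r → Finset (Fin h)), Function.Injective u →
      IsLowerSet (Set.range u) → HiddenStates.BallGood h h r u) :
    Summit.ValiantsHypothesis.ValiantsHypothesis.Theses.BarrierLever.PartitionMinorsHitByVP := by
  refine partitionMinorsHitByVP_of_lowerSets ⟨6, max h₁ 5, fun h hh r u w hu hw hlu hlw => ?_⟩
  have hh₁ : h₁ ≤ h := le_trans (le_max_left _ _) hh
  have h5 : 5 ≤ h := le_trans (le_max_right _ _) hh
  exact HiddenStates.partitionMinor_hit_of_ballGood_pair h h r h5 le_rfl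
    (Nat.le_mul_of_pos_left h (by omega)) u w hu (H h hh₁ r u hu hlu) (H h hh₁ r w hw hlw)

/-! ## 2. The same restriction for the doors of the cell -/

/-- **CPM on simplicial complexes suffices for item 19717.** If for `h ≥ h₀` every injective layout with
both ranges lower sets is hit by ONE product of `h + h` affine forms (the witness shape of item 20172
`ChowHitsPartitionMinors`), then `PartitionMinorsHitByVP` holds (`b = 7`). [cite: ForbesShpilkaVolk2018, §8] -/
theorem partitionMinorsHitByVP_of_chow_lowerSets (h₀ : ℕ)
    (H : ∀ h : ℕ, h₀ ≤ h → ∀ (r : ℕ) (u w : Fin r → Finset (Fin h)),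
      Function.Injective u → Function.Injective w →
      IsLowerSet (Set.range u) → IsLowerSet (Set.range w) →
      ∃ ℓ : Fin (h + h) → MvPolynomial (Fin (h + h)) ℂ, (∀ k, (ℓ k).totalDegree ≤ 1) ∧
        (Matrix.of fun i j : Fin r => MvPolynomial.coeff
          (∑ a ∈ u i, Finsupp.single (Fin.castAdd h a) 1 +
            ∑ c ∈ w j, Finsupp.single (Fin.natAdd h c) 1) (∏ k, ℓ k)).det ≠ 0) :
    Summit.ValiantsHypothesis.ValiantsHypothesis.Theses.BarrierLever.PartitionMinorsHitByVP := by
  refine partitionMinorsHitByVP_of_lowerSets ⟨3, max h₀ 2, fun h hh r u w hu hw hlu hlw => ?_⟩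
  obtain ⟨ℓ, hℓ, hdet⟩ := H h (le_trans (le_max_left _ _) hh) r u w hu hw hlu hlw
  have h3 : 3 ≤ h + h := by have := le_trans (le_max_right h₀ 2) hh; omega
  exact ⟨∏ k, ℓ k, ChowLadder.prod_affine_mem_smallCircuits h3 ℓ hℓ, hdet⟩

/-- **The SUM door on simplicial complexes suffices.** If for `h ≥ 3` every injective layout with both
ranges lower sets admits additive tables with `det (A + B) ≠ 0` (val-np-p6's door of record v6,
`AdditiveDoor.partitionMinor_hit_of_additiveSum_mem`), then `PartitionMinorsHitByVP` holds (`b = 9`). -/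
theorem partitionMinorsHitByVP_of_additiveSum_lowerSets
    (H : ∀ h : ℕ, 3 ≤ h → ∀ (r : ℕ) (u w : Fin r → Finset (Fin h)),
      Function.Injective u → Function.Injective w →
      IsLowerSet (Set.range u) → IsLowerSet (Set.range w) →
      ∃ (ω₀ : Fin h → ℂ) (ω : Fin h → Fin h → ℂ) (ω₀' : Fin h → ℂ) (ω' : Fin h → Fin h → ℂ),
        (Matrix.of fun i j : Fin r => ∏ c ∈ w j, (ω₀ c + ∑ a ∈ u i, ω a c) +
          ∏ a ∈ u i, (ω₀' a + ∑ c ∈ w j, ω' c a)).det ≠ 0) :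
    Summit.ValiantsHypothesis.ValiantsHypothesis.Theses.BarrierLever.PartitionMinorsHitByVP := by
  refine partitionMinorsHitByVP_of_lowerSets ⟨5, 3, fun h hh r u w hu hw hlu hlw => ?_⟩
  obtain ⟨ω₀, ω, ω₀', ω', hdet⟩ := H h hh r u w hu hw hlu hlw
  exact AdditiveDoor.partitionMinor_hit_of_additiveSum_mem h hh u w ω₀ ω ω₀' ω' hdet

/-- **The ROABP door on simplicial complexes suffices.** If for `h ≥ h₀` every injective layout with
both ranges lower sets has an ROABP certificate of width `m ≤ (2h)^c` (the planner's door,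
`RoabpDoor.partitionMinor_hit_of_roabpCertificate`), then `PartitionMinorsHitByVP` holds
(`b = 3c + 7`). [cite: ForbesShpilkaVolk2018, §8] -/
theorem partitionMinorsHitByVP_of_roabp_lowerSets (c h₀ : ℕ)
    (H : ∀ h : ℕ, h₀ ≤ h → ∀ (r : ℕ) (u w : Fin r → Finset (Fin h)),
      Function.Injective u → Function.Injective w →
      IsLowerSet (Set.range u) → IsLowerSet (Set.range w) →
      ∃ (m : ℕ) (_ : m ≤ (h + h) ^ c) (π : Equiv.Perm (Fin (h + h)))
        (P Q : Fin (h + h) → Matrix (Fin m) (Fin m) ℂ) (l rr : Fin m → ℂ),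
        (Summit.ValiantsHypothesis.Theorems.BarrierLever.RoabpDoor.roabpCertMatrix u w π P Q l rr).det ≠ 0) :
    Summit.ValiantsHypothesis.ValiantsHypothesis.Theses.BarrierLever.PartitionMinorsHitByVP := by
  refine partitionMinorsHitByVP_of_lowerSets ⟨3 * c + 3, max h₀ 2, fun h hh r u w hu hw hlu hlw => ?_⟩
  obtain ⟨m, hm, π, P, Q, l, rr, hdet⟩ := H h (le_trans (le_max_left _ _) hh) r u w hu hw hlu hlw
  have h4 : 4 ≤ h + h := by have := le_trans (le_max_right h₀ 2) hh; omega
  exact Summit.ValiantsHypothesis.Theorems.BarrierLever.RoabpDoor.partitionMinor_hit_of_roabpCertificate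
    h m c hm h4 u w π P Q l rr hdet

end

end Summit.ValiantsHypothesis.ValiantsHypothesis.Theorems.BarrierLever.DownCompression
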